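import Literature.MathematicalPhysics.StatisticalMechanics.NJLMassDerivative
import Literature.MathematicalPhysics.StatisticalMechanics.ComplexSpinMeanFieldBound
import Literature.MathematicalPhysics.StatisticalMechanics.ComplexSpinFluctuationBound
import HarnessLib

/-!
# The lower bound on the chiral condensate: Salmhofer–Seiler's Theorem 4.3 (4.8) and
# Corollary 4.4 (1) (CMP 139 (1991), §4, (4.8)–(4.16); the Ward identity (3.43))

A further file of the Salmhofer–Seiler series; theorems only (no definition, no named fact).
`ComplexSpinMeanFieldBound` proves the UPPER half (4.6) of Theorem 4.3, `⟨σ_x⟩ ≤ s₁`, and records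
that the LOWER half (4.8) — `⟨σ_x⟩ ≥ s₂` for `m > 0`, `ν ≥ 3`, `2S(ν)/N < 1`, i.e. chiral symmetry
breaking for strongly coupled lattice QED / the NJL system, Cor. 4.4 (1) — was not formalised
because its printed proof ((4.10)–(4.15), p. 418–419) needs, beyond the Schwinger–Dyson equation
(4.10) and the infrared bound, the identification of the zero mode of `T̂` with `C(0) s²`
((4.13): "`T̂ = C(0) s² δ + ĝ`"), that is clustering of the infinite-volume state at `m > 0`.
This file proves (4.8) and (4.16).  The two inputs the print takes from §3 are supplied as follows:

* the `k = 0` mode: `NJLMassDerivative.njl_susceptibility_bound` — at real `m > 0` the truncated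
  two-point function is summable uniformly in the volume, `|∑_y ⟨σ_0;σ_y⟩_Λ| ≤ 1/(N m²)`, so that on
  the finite torus `ĝ_Λ(0) = ∑_y [σ_0σ_y]_Λ ≤ Z_Λ (|Λ| s_Λ² + 1/(Nm²))` (`njl_twoPtHat_zero_le`);
* the `k = π̂` mode: **the Ward identity (3.43)** of the space-dependent chiral rotations,
  `⟨ψ̄ψ(y)⟩ = -m ∑_x ε(x)ε(y) ⟨ψ̄ψ(x) ψ̄ψ(y)⟩`, here derived on the finite even torus for every
  complex spin system with `B = exp(NW)` to order `N` as the `ε`-weighted sum of the Schwinger–Dyson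
  equations (3.44) (`ward_identity`: `[σ_y]_Λ = -2Nm ∑_x ε(x)ε(y)[σ_xσ_y]_Λ`), which evaluates the
  staggered mode exactly: `2Nm ĝ_Λ(π̂) = -[σ_0]_Λ` (`twoPtHat_stagChar_eq`).

With these, (4.12)–(4.14) are carried out on the finite torus exactly as the tree does for Thm. 4.8
(`ComplexSpinChiralLRO.sum_twoPt_nbr_le`, the finite-volume (4.40): the infrared bound mode by mode
off `{0, π̂}` and the lattice sum `S_Λ(ν)`), giving **(4.15) in finite volume**
(`njl_sd_ineq_finiteVolume`):
`1 - 2m s_Λ ≤ 2ν s_Λ² + (2/N) S_Λ(ν) + (2ν/|Λ|)(1/(Nm²) + s_Λ/(2Nm))`, `s_Λ = ⟨σ_0⟩_Λ(m)`,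
on every even torus; then `L → ∞` along even tori (`latticeS_tendsto_fluctS`: `S_Λ(ν) → S(ν)` for
`ν ≥ 3`; the one-point function converges by Cor. 3.9, `NJLThermodynamicLimit`) gives the printed
**(4.15)** `1 - 2ms ≤ 2νs² + (2/N)S(ν)` (`njl_sd_ineq_limit`), hence **Theorem 4.3 (4.8)**
`s ≥ s₂ = (√(m² + 2ν(1 - 2S(ν)/N)) - m)/(2ν)`, the positive solution of (4.9)
(`njl_condensate_ge_meanField`, packaged with (4.6) and Cor. 3.9 in `njl_condensate_bounds`), and
**Corollary 4.4 (1) (4.16)**: the chiral order parameter `X = liminf_{m→0} ⟨ψ̄ψ⟩ = 2N liminf_{m→0+} s(m)`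
satisfies `1/√(2ν) ≥ X/(2N) ≥ (1/√(2ν)) (1 - 2S(ν)/N)^{1/2}` (`njl_chiralOrderParameter_bounds`).

Faithfulness / scope.  `β = 0` NJL system / strongly coupled `U(N)` lattice gauge theory in
Salmhofer–Seiler's complex-spin form (Def. 3.3 (1)) on the even tori `(ℤ/Lℤ)^ν`, real mass; the
thermodynamic limit is taken along sequences of even tori, as everywhere in the tree's treatment of
§4.  The Ward identity is the finite-volume, untruncated form of (3.43) (on the even torus
`∑_x ε(x) = 0`, so the truncation is immaterial, as the paper remarks).  Positivity of `S(ν)` and the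
numerical condition `2S(ν)/N < 1` (Prop. 4.2, (4.4)–(4.5)) are hypotheses here, discharged for
`ν ≥ 4` / `ν = 4, N ≤ 3` elsewhere in the tree (`ComplexSpinFluctuation*`).  Nothing about `β > 0`,
the continuum, a mass gap or the summit's `QCD` conjunct.

## References

* M. Salmhofer, E. Seiler, *Proof of chiral symmetry breaking in strongly coupled lattice gauge
  theory*, Commun. Math. Phys. 139 (1991) 395–432: (3.43)–(3.46) p. 409, Def. 4.1, Thm. 4.3 with
  its proof (4.6)–(4.15) p. 418–419, Cor. 4.4 (1) (4.16) p. 419. [SalmhoferSeiler1991]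
* M. Salmhofer, E. Seiler, Erratum, Commun. Math. Phys. 146 (1992) 637–638. [SalmhoferSeiler1992Erratum]
-/

noncomputable section

open MvPolynomial Finset Filter Topology
open Literature.Probability.LatticeModels (TorusSite Site)
open Literature.Probability.LatticeModels

namespace Literature.MathematicalPhysics.StatisticalMechanics

namespace ComplexSpin

variable {ν L : ℕ}

/-! ### The Ward identity (3.43) on the finite torus -/

section Ward

variable [NeZero L]

/-- The `ε`-weighted sum over the sites of the bond terms of the Schwinger–Dyson equations vanishes:
`∑_x ε(x) ∑_{y:|y-x|=1} σ_xσ_y W'(σ_xσ_y) = 0` — every bond `⟨xy⟩` occurs once with `ε(x)` and once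
with `ε(y) = -ε(x)` (the generator of the space-dependent chiral rotation `σ_x ↦ e^{iαε(x)}σ_x`
annihilates the bond weights). [cite: SalmhoferSeiler1991, (3.43)–(3.46)] -/
theorem sum_sgn_mul_linkSum (hL : 2 ∣ L) (N : ℕ) (w : ℕ → ℝ) :
    ∑ x : TorusSite ν L, C ((sgn hL x : ℤ) : ℝ) * linkSum N w x = 0 := by
  classical
  unfold linkSum
  simp_rw [Finset.mul_sum]
  rw [Finset.sum_comm]
  refine Finset.sum_eq_zero fun μ _ => ?_
  simp_rw [mul_add]
  rw [Finset.sum_add_distrib]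
  have h : ∑ x : TorusSite ν L, C ((sgn hL x : ℤ) : ℝ) * omega N w (x - Pi.single μ 1) x =
      -∑ x : TorusSite ν L, C ((sgn hL x : ℤ) : ℝ) * omega N w x (x + Pi.single μ 1) := by
    rw [← Finset.sum_neg_distrib]
    refine (Fintype.sum_equiv
      ((Equiv.addRight (Pi.single μ (1 : ZMod L))) : TorusSite ν L ≃ TorusSite ν L)
      (fun x : TorusSite ν L => -(C ((sgn hL x : ℤ) : ℝ) * omega N w x (x + Pi.single μ 1)))
      (fun x : TorusSite ν L => C ((sgn hL x : ℤ) : ℝ) * omega N w (x - Pi.single μ 1) x)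
      fun x => ?_).symm
    simp only [Equiv.coe_addRight, add_sub_cancel_right, sgn_add_single, Int.cast_neg, map_neg,
      neg_mul]
  rw [h, add_neg_cancel]

/-- **The Ward identity (3.43) in finite volume.**  For a complex spin system with `B = exp(NW)` to
order `N` on an even torus of side `≥ 2` (`ν ≥ 1`), every real mass `m` and every site `y`:
`[σ_y]_Λ = -2Nm ∑_x ε(x)ε(y) [σ_xσ_y]_Λ`, i.e. `⟨ψ̄ψ(y)⟩ = -m ∑_x ε(x)ε(y)⟨ψ̄ψ(x)ψ̄ψ(y)⟩` with
`ψ̄ψ = 2Nσ` — the `ε`-weighted sum over `x` of the Schwinger–Dyson equations (3.44) for `Φ = σ_y`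
(`∑_x ε(x) = 0` kills the left side and the bond terms; "the truncation can be included because
of the alternating signs"). [cite: SalmhoferSeiler1991, (3.43) with (3.44)–(3.46)] -/
theorem ward_identity (hL : 2 ∣ L) (hL2 : 2 ≤ L) (hν : 1 ≤ ν) {N : ℕ} {a w : ℕ → ℝ}
    (hlog : HasLog N a w) (m : ℝ) (y : TorusSite ν L) :
    bracket N m a (X y) =
      -(2 * N * m) * ∑ x : TorusSite ν L,
        (sgn hL x : ℝ) * (sgn hL y : ℝ) * bracket N m a (X x * X y) := by
  classical
  -- the SD equation at every site `x` for `Φ = σ_y`, weighted by `ε(x)`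
  have hsd : ∀ x : TorusSite ν L, (sgn hL x : ℝ) * ((N : ℝ) * bracket N m a (X y)) =
      (sgn hL x : ℝ) * (bracket N m a (euler x (X y)) + 2 * N * m * bracket N m a (X x * X y) +
        N * bracket N m a (linkSum N w x * X y)) := fun x => by
    rw [schwingerDyson hlog hL2 m x (X y)]
  have hsum := Finset.sum_congr rfl fun x (_ : x ∈ (Finset.univ : Finset (TorusSite ν L))) => hsd x
  -- left side: `∑_x ε(x) = 0`
  have hlhs : ∑ x : TorusSite ν L, (sgn hL x : ℝ) * ((N : ℝ) * bracket N m a (X y)) = 0 := by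
    rw [← Finset.sum_mul]
    have : ∑ x : TorusSite ν L, ((sgn hL x : ℤ) : ℝ) = 0 := by
      exact_mod_cast sum_sgn_eq_zero (ν := ν) hL hν
    rw [this, zero_mul]
  -- the Euler term: `[σ_x∂_x σ_y]_Λ = δ_{xy} [σ_y]_Λ`
  have hXy : (X y : MvPolynomial (TorusSite ν L) ℝ) = monomial (Finsupp.single y 1) 1 := rfl
  have heuler : ∀ x : TorusSite ν L, bracket N m a (euler x (X y)) =
      ((Finsupp.single y 1 x : ℕ) : ℝ) * bracket N m a (X y) := by
    intro x
    rw [hXy, euler_monomial, bracket_C_mul]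
  have h1 : ∑ x : TorusSite ν L, (sgn hL x : ℝ) * bracket N m a (euler x (X y)) =
      (sgn hL y : ℝ) * bracket N m a (X y) := by
    simp_rw [heuler]
    rw [Finset.sum_eq_single y]
    · rw [Finsupp.single_eq_same, Nat.cast_one, one_mul]
    · intro x _ hxy
      rw [Finsupp.single_apply, if_neg (Ne.symm hxy), Nat.cast_zero, zero_mul, mul_zero]
    · intro h; exact absurd (Finset.mem_univ y) h
  -- the bond terms vanish
  have h3 : ∑ x : TorusSite ν L,
      (sgn hL x : ℝ) * ((N : ℝ) * bracket N m a (linkSum N w x * X y)) = 0 := by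
    have : ∀ x : TorusSite ν L, (sgn hL x : ℝ) * ((N : ℝ) * bracket N m a (linkSum N w x * X y)) =
        (N : ℝ) * bracket N m a (C ((sgn hL x : ℤ) : ℝ) * linkSum N w x * X y) := by
      intro x; rw [mul_assoc (C _), bracket_C_mul]; ring
    simp_rw [this]
    rw [← Finset.mul_sum, ← bracket_sum, ← Finset.sum_mul, sum_sgn_mul_linkSum hL N w, zero_mul,
      bracket_zero, mul_zero]
  -- assemble: `0 = ε(y)[σ_y] + 2Nm ∑_x ε(x)[σ_xσ_y]`
  have key : (sgn hL y : ℝ) * bracket N m a (X y) +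
      2 * N * m * ∑ x : TorusSite ν L, (sgn hL x : ℝ) * bracket N m a (X x * X y) = 0 := by
    have h := hsum
    rw [hlhs] at h
    simp_rw [mul_add] at h
    rw [Finset.sum_add_distrib, Finset.sum_add_distrib, h1, h3, add_zero] at h
    rw [h, Finset.mul_sum]
    congr 1
    exact Finset.sum_congr rfl fun x _ => by ring
  have hy : (sgn hL y : ℝ) * (sgn hL y : ℝ) = 1 := by
    unfold sgn; split_ifs <;> norm_num
  have hS : ∑ x : TorusSite ν L, (sgn hL x : ℝ) * (sgn hL y : ℝ) * bracket N m a (X x * X y) =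
      (sgn hL y : ℝ) * ∑ x : TorusSite ν L, (sgn hL x : ℝ) * bracket N m a (X x * X y) := by
    rw [Finset.mul_sum]
    exact Finset.sum_congr rfl fun x _ => by ring
  rw [hS]
  calc bracket N m a (X y) = (sgn hL y : ℝ) * ((sgn hL y : ℝ) * bracket N m a (X y)) := by
        rw [← mul_assoc, hy, one_mul]
    _ = _ := by
        rw [eq_neg_of_add_eq_zero_left key]
        ring

/-- The constant mode of the two-point kernel: `ĝ_Λ(0) = ∑_z [σ_0σ_z]_Λ` (`|Λ| Z_Λ c_0` of (3.108)).
[cite: SalmhoferSeiler1991, (3.105) and (3.108)] -/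
theorem twoPtHat_zero_eq_sum (N : ℕ) (m : ℝ) (a : ℕ → ℝ) :
    twoPtHat N m a (0 : AddChar (TorusSite ν L) ℂ) =
      ∑ z : TorusSite ν L, twoPt N m a (0 : TorusSite ν L) z := by
  unfold twoPtHat kernelSymbol
  rw [Complex.re_sum]
  refine Finset.sum_congr rfl fun z _ => ?_
  rw [AddChar.zero_apply, mul_one, Complex.ofReal_re]

/-- The staggered mode: `ĝ_Λ(π̂) = ∑_z ε(z) [σ_0σ_z]_Λ` (`|Λ| Z_Λ c_π̂` of (3.108)).
[cite: SalmhoferSeiler1991, (3.105) and (3.108)] -/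
theorem twoPtHat_stagChar_eq_sum (hL : 2 ∣ L) (N : ℕ) (m : ℝ) (a : ℕ → ℝ) :
    twoPtHat N m a (stagChar (ν := ν) (L := L) hL) =
      ∑ z : TorusSite ν L, (sgn hL z : ℝ) * twoPt N m a (0 : TorusSite ν L) z := by
  unfold twoPtHat kernelSymbol
  rw [Complex.re_sum]
  refine Finset.sum_congr rfl fun z _ => ?_
  rw [stagChar_apply]
  unfold sgn
  by_cases hz : parity hL z = 0
  · rw [if_pos hz, if_pos hz]; simp
  · rw [if_neg hz, if_neg hz]; simp

/-- **The staggered mode by the Ward identity**: `2Nm ĝ_Λ(π̂) = -[σ_0]_Λ` on the even torus, for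
every complex spin system with `B = exp(NW)` to order `N` — (3.43) at `y = 0` read through
`ĝ_Λ(π̂) = ∑_x ε(x)[σ_0σ_x]_Λ`; in particular `ĝ_Λ(π̂) ≤ 0 ≤ -ĝ_Λ(π̂) = Z_Λ⟨σ_0⟩_Λ/(2Nm)` for
`m > 0`. [cite: SalmhoferSeiler1991, (3.43) with (3.108)] -/
theorem twoPtHat_stagChar_eq (hL : 2 ∣ L) (hL2 : 2 ≤ L) (hν : 1 ≤ ν) {N : ℕ} {a w : ℕ → ℝ}
    (hlog : HasLog N a w) (m : ℝ) :
    2 * N * m * twoPtHat N m a (stagChar (ν := ν) (L := L) hL) =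
      -bracket N m a (X (0 : TorusSite ν L)) := by
  rw [twoPtHat_stagChar_eq_sum, ward_identity hL hL2 hν hlog m 0]
  simp_rw [sgn_zero hL, Int.cast_one, mul_one, twoPt]
  simp_rw [bracket_X_mul_X_comm N m a _ (0 : TorusSite ν L)]
  ring

/-- **Translation invariance of the one-point function**: `[σ_y]_Λ = [σ_0]_Λ`. [cite: SalmhoferSeiler1991, Def. 3.1 (torus) and (3.31)] -/
theorem bracket_X_eq_bracket_X_zero (N : ℕ) (m : ℝ) (a : ℕ → ℝ) (y : TorusSite ν L) :
    bracket N m a (X y) = bracket N m a (X (0 : TorusSite ν L)) := by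
  rw [← bracket_rename_addRight N m a y (X 0), rename_X, zero_add]

/-- `⟨σ_y⟩_Λ = ⟨σ_0⟩_Λ`. [cite: SalmhoferSeiler1991, Def. 3.1 (torus) and (3.31)] -/
theorem expect_X_eq_expect_X_zero (N : ℕ) (m : ℝ) (a : ℕ → ℝ) (y : TorusSite ν L) :
    expect N m a (X y) = expect N m a (X (0 : TorusSite ν L)) := by
  rw [expect_eq_div, expect_eq_div, bracket_X_eq_bracket_X_zero]

end Ward

/-! ### The NJL system in finite volume: (4.10), the two exceptional modes, (4.15)_Λ -/

section NJL

variable [NeZero L] {N : ℕ}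

/-- An even positive side is `≥ 2`. [folklore] -/
private theorem two_le_of_even (hL : Even L) : 2 ≤ L := by
  obtain ⟨k, hk⟩ := hL
  have := NeZero.ne L
  omega

/-- `a_k = N^k/k! ≥ 0`. [cite: SalmhoferSeiler1991, Def. 3.3 (1)] -/
private theorem njlBondCoeff_nonneg' (N k : ℕ) : 0 ≤ njlBondCoeff N k := by
  unfold njlBondCoeff; positivity

/-- `a_k = N^k/k! > 0` for `N ≥ 1`. [cite: SalmhoferSeiler1991, Def. 3.3 (1)] -/
private theorem njlBondCoeff_pos' (hN : 1 ≤ N) (k : ℕ) : 0 < njlBondCoeff N k := by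
  unfold njlBondCoeff
  have : (0 : ℝ) < N := by exact_mod_cast hN
  positivity

/-- `Z_Λ > 0` for the NJL system on an even torus at `m ≥ 0`. [cite: SalmhoferSeiler1991, Def. 3.1 and Thm. 3.18 (1)] -/
theorem njl_partitionFunction_pos (hν : 1 ≤ ν) (hL : Even L) (hN : 1 ≤ N) {m : ℝ} (hm : 0 ≤ m) :
    0 < partitionFunction (ν := ν) (L := L) N m (njlBondCoeff N) :=
  partitionFunction_pos hL.two_dvd (two_le_of_even hL) hν hm (fun k _ => njlBondCoeff_nonneg' N k)
    (njlBondCoeff_pos' hN 0) (njlBondCoeff_pos' hN N)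

/-- The NJL system satisfies the hypothesis `b_k ≥ 0` of the infrared bound (Remark 4.5).
[cite: SalmhoferSeiler1991, Remark 4.5] -/
theorem njl_fluctCoeff_nonneg (N : ℕ) : ∀ k ≤ N, 0 ≤ fluctCoeff N (njlBondCoeff N) k :=
  fluctCoeff_nonneg_of_hasLog (hasLog_njl N) (njlBondCoeff_zero N) (by simp)
    (fun k hk _ => by rw [Pi.single_eq_of_ne (by omega : k ≠ 1)])

/-- `0 ≤ ⟨σ_x⟩_Λ` for the NJL system. [cite: SalmhoferSeiler1991, Thm. 3.18 (1) (3.59)] -/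
theorem njl_expect_X_nonneg (hν : 1 ≤ ν) (hL : Even L) (hN : 1 ≤ N) {m : ℝ} (hm : 0 ≤ m)
    (x : TorusSite ν L) : 0 ≤ expect N m (njlBondCoeff N) (X x) :=
  expect_X_nonneg hν hL (two_le_of_even hL) hN (hasLog_njl N) (njlBondCoeff_zero N) (by simp)
    (fun k hk _ => by rw [Pi.single_eq_of_ne (by omega : k ≠ 1)]) hm x

/-- `⟨σ_x⟩_Λ ≤ 1/√(2ν)` for the NJL system ((4.16), upper inequality, in finite volume).
[cite: SalmhoferSeiler1991, Cor. 4.4 (1) (4.16)] -/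
theorem njl_expect_X_le_inv_sqrt (hν : 1 ≤ ν) (hL : Even L) (hN : 1 ≤ N) {m : ℝ} (hm : 0 ≤ m)
    (x : TorusSite ν L) : expect N m (njlBondCoeff N) (X x) ≤ 1 / Real.sqrt (2 * ν) :=
  expect_X_le_inv_sqrt hν hL (two_le_of_even hL) hN (hasLog_njl N) (njlBondCoeff_zero N) (by simp)
    (fun k hk _ => by rw [Pi.single_eq_of_ne (by omega : k ≠ 1)]) hm x

/-- **(4.10) in finite volume**: for the NJL system (`W' = 1`) the `L = 0` Schwinger–Dyson
equation is the identity `Z_Λ = 2m[σ_0]_Λ + ∑_{|y|=1}[σ_0σ_y]_Λ`, i.e.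
`1 - 2m⟨σ_0⟩_Λ = ∑_{y:|y|=1}⟨σ_0σ_y⟩_Λ`. [cite: SalmhoferSeiler1991, (4.10) with (3.46)] -/
theorem njl_partitionFunction_eq_sd (hN : 1 ≤ N) (hL2 : 2 ≤ L) (m : ℝ) :
    partitionFunction (ν := ν) (L := L) N m (njlBondCoeff N) =
      2 * m * bracket N m (njlBondCoeff N) (X (0 : TorusSite ν L)) +
        ∑ μ : Fin ν, (twoPt N m (njlBondCoeff N) (0 : TorusSite ν L) (Pi.single μ 1) +
          twoPt N m (njlBondCoeff N) (0 : TorusSite ν L) (-Pi.single μ 1)) := by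
  rw [partitionFunction_eq_sd' hN (hasLog_njl N) hL2 m 0, ← sum_bracket_nbr_zero]
  congr 1
  refine Finset.sum_congr rfl fun s _ => ?_
  rw [Finset.sum_eq_single 1]
  · simp
  · intro k _ hk
    rw [Pi.single_eq_of_ne hk, mul_zero, zero_mul]
  · intro h; exact absurd (Finset.mem_range.2 (by omega : 1 < N + 1)) h

/-- At real mass the tree's `Z_Λ` is the capacity partition function `Z_Λ(N,…,N)(m)` of
`NJLHoppingLocality`. [cite: SalmhoferSeiler1991, (3.1) and Remark 3.2] -/
theorem njl_partitionFunction_ofReal (N : ℕ) (m : ℝ) :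
    ((partitionFunction (ν := ν) (L := L) N m (njlBondCoeff N) : ℝ) : ℂ) =
      njlCapZ N (topExponent (ν := ν) (L := L) N) (m : ℂ) := by
  rw [← njlPartitionFunctionC_ofReal, njlPartitionFunctionC_eq_Z]
  rfl

/-- `[σ_y]_Λ(m) = Z_Λ(N - δ_y)(m)` (Remark 3.2). [cite: SalmhoferSeiler1991, Remark 3.2 and (3.30)] -/
theorem njl_bracket_X_ofReal (hN : 1 ≤ N) (m : ℝ) (y : TorusSite ν L) :
    ((bracket N m (njlBondCoeff N) (X y) : ℝ) : ℂ) =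
      njlCapZ N (topExponent N - Finsupp.single y 1) (m : ℂ) := by
  have hXy : (X y : FieldAlg ν L) = monomial (Finsupp.single y 1) 1 := rfl
  have hle : Finsupp.single y 1 ≤ topExponent (ν := ν) (L := L) N :=
    Finsupp.single_le_iff.2 (by rw [topExponent_apply']; exact hN)
  rw [← njlBracketC_ofReal, map_X, hXy, njlBracketC_monomial, if_pos hle]
  rfl

/-- `[σ_0σ_z]_Λ(m) = Zd_Λ(N - δ_0, z)(m)`: the two-point bracket is the "dropped" capacity partition
function of `NJLMassDerivative` (which is `0` for `z = 0`, `N = 1`, as is `[σ_0²]_Λ` then).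
[cite: SalmhoferSeiler1991, Remark 3.2 and (3.30)] -/
theorem njl_twoPt_ofReal (hN : 1 ≤ N) (m : ℝ) (z : TorusSite ν L) :
    ((twoPt N m (njlBondCoeff N) (0 : TorusSite ν L) z : ℝ) : ℂ) =
      njlCapZdrop N (topExponent N - Finsupp.single (0 : TorusSite ν L) 1) z (m : ℂ) := by
  classical
  have hX : (X (0 : TorusSite ν L) * X z : FieldAlg ν L) =
      monomial (Finsupp.single 0 1 + Finsupp.single z 1) 1 := by
    rw [X, X, monomial_mul, mul_one]
  have h0 : Finsupp.single (0 : TorusSite ν L) 1 ≤ topExponent (ν := ν) (L := L) N :=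
    Finsupp.single_le_iff.2 (by rw [topExponent_apply']; exact hN)
  have hiff : Finsupp.single (0 : TorusSite ν L) 1 + Finsupp.single z 1 ≤
        topExponent (ν := ν) (L := L) N ↔
      z ∈ (topExponent (ν := ν) (L := L) N - Finsupp.single 0 1).support := by
    rw [← le_tsub_iff_left h0, Finsupp.single_le_iff, Finsupp.mem_support_iff,
      Nat.one_le_iff_ne_zero]
  rw [twoPt, ← njlBracketC_ofReal, map_mul, map_X, map_X, hX, njlBracketC_monomial]
  unfold njlCapZdrop njlCapZ
  by_cases h : z ∈ (topExponent (ν := ν) (L := L) N - Finsupp.single 0 1).support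
  · rw [if_pos (hiff.2 h), if_pos h, tsub_tsub]
  · rw [if_neg (mt hiff.1 h), if_neg h]

/-- `⟨σ_y⟩_Λ(m) = ρ_Λ(y, (N,…,N))(m)`: the tree's expectation is the one-step ratio of
`NJLHoppingLocality`. [cite: SalmhoferSeiler1991, (3.2) and (3.46)] -/
theorem njl_expect_X_ofReal (hN : 1 ≤ N) (m : ℝ) (y : TorusSite ν L) :
    ((expect N m (njlBondCoeff N) (X y) : ℝ) : ℂ) =
      njlCapRatio N y (topExponent (ν := ν) (L := L) N) (m : ℂ) := by
  rw [expect_eq_div, Complex.ofReal_div, njl_bracket_X_ofReal hN, njl_partitionFunction_ofReal]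
  rfl

/-- **The `k = 0` mode (the content of "`T̂ = C(0)s²δ + ĝ`" in (4.13), in finite volume).**  For the
NJL system at real `m > 0` on any even torus:
`ĝ_Λ(0) = ∑_y [σ_0σ_y]_Λ ≤ Z_Λ (|Λ| ⟨σ_0⟩_Λ² + 1/(Nm²))` — the zero mode is `|Λ|` times the square
of the condensate up to the volume-independent susceptibility bound of `NJLMassDerivative`.
[cite: SalmhoferSeiler1991, Thm. 4.3 (proof, (4.13))] -/
theorem njl_twoPtHat_zero_le (hν : 1 ≤ ν) (hL : Even L) (hN : 1 ≤ N) {m : ℝ} (hm : 0 < m) :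
    twoPtHat N m (njlBondCoeff N) (0 : AddChar (TorusSite ν L) ℂ) ≤
      partitionFunction (ν := ν) (L := L) N m (njlBondCoeff N) *
        (Fintype.card (TorusSite ν L) * expect N m (njlBondCoeff N) (X (0 : TorusSite ν L)) ^ 2 +
          1 / (N * m ^ 2)) := by
  have hZ : 0 < partitionFunction (ν := ν) (L := L) N m (njlBondCoeff N) :=
    njl_partitionFunction_pos hν hL hN hm.le
  -- the susceptibility bound, read in the tree's real vocabulary
  have hχ := njl_susceptibility_bound (ν := ν) (L := L) hN (0 : Site ν) hm
  have hp0 : Torus.proj L (0 : Site ν) = 0 := by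
    funext i; simp [Torus.proj]
  rw [hp0] at hχ
  have hterm : ∀ y : TorusSite ν L,
      njlCapZdrop N (topExponent N - Finsupp.single (0 : TorusSite ν L) 1) y (m : ℂ) /
          njlCapZ N (topExponent (ν := ν) (L := L) N) (m : ℂ) -
        njlCapRatio N 0 (topExponent (ν := ν) (L := L) N) (m : ℂ) *
          njlCapRatio N y (topExponent (ν := ν) (L := L) N) (m : ℂ) =
      ((twoPt N m (njlBondCoeff N) 0 y / partitionFunction (ν := ν) (L := L) N m (njlBondCoeff N) -
        expect N m (njlBondCoeff N) (X (0 : TorusSite ν L)) *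
          expect N m (njlBondCoeff N) (X (0 : TorusSite ν L)) : ℝ) : ℂ) := by
    intro y
    rw [← njl_twoPt_ofReal hN m y, ← njl_partitionFunction_ofReal N m, ← njl_expect_X_ofReal hN m 0,
      ← njl_expect_X_ofReal hN m y, expect_X_eq_expect_X_zero N m _ y]
    push_cast
    ring
  simp_rw [hterm] at hχ
  rw [← Complex.ofReal_sum, Complex.norm_real, Real.norm_eq_abs] at hχ
  have h := (abs_le.1 hχ).2
  rw [Finset.sum_sub_distrib, Finset.sum_const, Finset.card_univ, nsmul_eq_mul,
    ← Finset.sum_div] at h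
  rw [twoPtHat_zero_eq_sum]
  have h' : (∑ z : TorusSite ν L, twoPt N m (njlBondCoeff N) (0 : TorusSite ν L) z) /
      partitionFunction (ν := ν) (L := L) N m (njlBondCoeff N) ≤
        Fintype.card (TorusSite ν L) * expect N m (njlBondCoeff N) (X (0 : TorusSite ν L)) ^ 2 +
          1 / (N * m ^ 2) := by
    rw [sq]; linarith
  rwa [div_le_iff₀ hZ, mul_comm] at h'

/-- **(4.15) in finite volume.**  For the NJL system (`N ≥ 1`) on the even torus `Λ = (ℤ/Lℤ)^ν`
(`ν ≥ 1`) at real mass `m > 0`, with `s_Λ = ⟨σ_0⟩_Λ(m)` and the lattice sum `S_Λ(ν)` of (4.3):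
`1 - 2m s_Λ ≤ 2ν s_Λ² + (2/N) S_Λ(ν) + (2ν/|Λ|)(1/(Nm²) + s_Λ/(2Nm))` — (4.10) `=` (4.12),
bounded by the finite-volume infrared form (4.40) of `∑_{|ξ|=1}T(ξ)`, with the two exceptional
modes evaluated by `njl_twoPtHat_zero_le` (`k = 0`) and the Ward identity (`k = π̂`); the last term
is the finite-size correction, absent in the printed infinite-volume (4.15). [cite: SalmhoferSeiler1991, Thm. 4.3 (proof, (4.10)–(4.15))] -/
theorem njl_sd_ineq_finiteVolume (hν : 1 ≤ ν) (hL : Even L) (hN : 1 ≤ N) {m : ℝ} (hm : 0 < m) :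
    1 - 2 * m * expect N m (njlBondCoeff N) (X (0 : TorusSite ν L)) ≤
      2 * ν * expect N m (njlBondCoeff N) (X (0 : TorusSite ν L)) ^ 2 +
        2 / N * latticeS ν L +
        2 * ν / Fintype.card (TorusSite ν L) *
          (1 / (N * m ^ 2) + expect N m (njlBondCoeff N) (X (0 : TorusSite ν L)) / (2 * N * m)) := by
  have hL2 : 2 ≤ L := two_le_of_even hL
  have hZ : 0 < partitionFunction (ν := ν) (L := L) N m (njlBondCoeff N) :=
    njl_partitionFunction_pos hν hL hN hm.le
  have hNpos : (0 : ℝ) < N := by exact_mod_cast hN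
  have hcard : (0 : ℝ) < Fintype.card (TorusSite ν L) := Nat.cast_pos.2 Fintype.card_pos
  -- (4.10), (4.40), the two modes
  have hsd := njl_partitionFunction_eq_sd (ν := ν) (L := L) hN hL2 m
  have hir := sum_twoPt_nbr_le hν hL hN m (njl_fluctCoeff_nonneg N)
  have h0 := njl_twoPtHat_zero_le hν hL hN hm
  have hπ := twoPtHat_stagChar_eq hL.two_dvd hL2 hν (hasLog_njl N) m
  set Z := partitionFunction (ν := ν) (L := L) N m (njlBondCoeff N) with hZdef
  set s := expect N m (njlBondCoeff N) (X (0 : TorusSite ν L)) with hsdef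
  set g0 := twoPtHat N m (njlBondCoeff N) (0 : AddChar (TorusSite ν L) ℂ) with hg0
  set gπ := twoPtHat N m (njlBondCoeff N) (stagChar (ν := ν) (L := L) hL.two_dvd) with hgπ
  set n : ℝ := (Fintype.card (TorusSite ν L) : ℝ) with hn
  have hbr : bracket N m (njlBondCoeff N) (X (0 : TorusSite ν L)) = s * Z := by
    rw [hsdef, expect_eq_div, div_mul_cancel₀ _ hZ.ne']
  rw [hbr] at hsd hπ
  -- `-ĝ(π̂) = Z s/(2Nm)`
  have hπ' : -gπ = Z * (s / (2 * N * m)) := by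
    have h2Nm : (2 * N * m : ℝ) ≠ 0 := by positivity
    field_simp
    linarith [hπ]
  have h1 : Z * (1 - 2 * m * s) ≤
      2 * ν / n * (Z * (n * s ^ 2 + 1 / (N * m ^ 2)) + Z * (s / (2 * N * m))) +
        2 / N * Z * latticeS ν L := by
    have hcoef : 0 ≤ 2 * (ν : ℝ) / n := by positivity
    have hmodes : g0 - gπ ≤ Z * (n * s ^ 2 + 1 / (N * m ^ 2)) + Z * (s / (2 * N * m)) := by
      rw [sub_eq_add_neg, hπ']
      linarith [h0]
    calc Z * (1 - 2 * m * s)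
        = ∑ μ : Fin ν, (twoPt N m (njlBondCoeff N) (0 : TorusSite ν L) (Pi.single μ 1) +
            twoPt N m (njlBondCoeff N) (0 : TorusSite ν L) (-Pi.single μ 1)) := by
          linear_combination hsd
      _ ≤ 2 * ν / n * (g0 - gπ) + 2 / N * Z * latticeS ν L := hir
      _ ≤ _ := by
          have := mul_le_mul_of_nonneg_left hmodes hcoef
          linarith
  have key : Z * (1 - 2 * m * s) ≤
      Z * (2 * ν * s ^ 2 + 2 / N * latticeS ν L +
        2 * ν / n * (1 / (N * m ^ 2) + s / (2 * N * m))) := by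
    refine h1.trans_eq ?_
    field_simp
    ring
  exact le_of_mul_le_mul_left key hZ

/-- **(4.15) in finite volume, with the finite-size term made explicit**: under the same
hypotheses, `1 - 2m s_Λ ≤ 2ν s_Λ² + (2/N) S_Λ(ν) + 5ν/(2Nm²|Λ|)` (using `0 ≤ s_Λ ≤ 1/(2m)` from
(4.6)). [cite: SalmhoferSeiler1991, Thm. 4.3 (proof, (4.10)–(4.15))] -/
theorem njl_sd_ineq_finiteVolume' (hν : 1 ≤ ν) (hL : Even L) (hN : 1 ≤ N) {m : ℝ} (hm : 0 < m) :
    1 - 2 * m * expect N m (njlBondCoeff N) (X (0 : TorusSite ν L)) ≤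
      2 * ν * expect N m (njlBondCoeff N) (X (0 : TorusSite ν L)) ^ 2 +
        2 / N * latticeS ν L + 5 * ν / (2 * N * m ^ 2 * Fintype.card (TorusSite ν L)) := by
  have hL2 : 2 ≤ L := two_le_of_even hL
  have h := njl_sd_ineq_finiteVolume hν hL hN hm
  have hmf := njl_meanField_ineq hν hL hL2 hN hm.le (0 : TorusSite ν L)
  have hs0 := njl_expect_X_nonneg hν hL hN hm.le (0 : TorusSite ν L)
  set s := expect N m (njlBondCoeff N) (X (0 : TorusSite ν L)) with hsdef
  have hNpos : (0 : ℝ) < N := by exact_mod_cast hN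
  have hν0 : (0 : ℝ) ≤ ν := by positivity
  have hcard : (0 : ℝ) < Fintype.card (TorusSite ν L) := Nat.cast_pos.2 Fintype.card_pos
  -- `2ms ≤ 1`, so `s/(2Nm) ≤ 1/(4Nm²)`
  have h2ms : 2 * m * s ≤ 1 := by nlinarith [sq_nonneg s]
  have hs1 : s / (2 * N * m) ≤ 1 / (4 * N * m ^ 2) := by
    rw [div_le_div_iff₀ (by positivity) (by positivity)]
    have h' := mul_le_mul_of_nonneg_right h2ms (by positivity : (0 : ℝ) ≤ 2 * N * m)
    linarith
  have herr : 2 * ν / Fintype.card (TorusSite ν L) * (1 / (N * m ^ 2) + s / (2 * N * m)) ≤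
      5 * ν / (2 * N * m ^ 2 * Fintype.card (TorusSite ν L)) := by
    calc 2 * ν / Fintype.card (TorusSite ν L) * (1 / (N * m ^ 2) + s / (2 * N * m))
        ≤ 2 * ν / Fintype.card (TorusSite ν L) * (1 / (N * m ^ 2) + 1 / (4 * N * m ^ 2)) :=
          mul_le_mul_of_nonneg_left (by linarith) (by positivity)
      _ = 5 * ν / (2 * N * m ^ 2 * Fintype.card (TorusSite ν L)) := by
          field_simp
          ring
  linarith

end NJL

/-! ### The thermodynamic limit: (4.15), Theorem 4.3 (4.8), Corollary 4.4 (1) -/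

section Limit

variable {N : ℕ}

/-- `S_Λ(ν) → S(ν)` along any sequence of even tori of diverging side (`ν ≥ 3`).
[cite: SalmhoferSeiler1991, Def. 4.1 (4.3) with (4.14)] -/
theorem tendsto_latticeS (hν : 3 ≤ ν) (Ls : ℕ → ℕ) [∀ j, NeZero (Ls j)]
    (heven : ∀ j, Even (Ls j)) (hLs : Tendsto Ls atTop atTop) :
    Tendsto (fun j => latticeS ν (Ls j)) atTop (𝓝 (fluctS ν)) := by
  rw [Metric.tendsto_atTop]
  intro ε hε
  obtain ⟨L₀, hL₀⟩ := latticeS_tendsto_fluctS (ν := ν) hν (half_pos hε)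
  obtain ⟨J, hJ⟩ := tendsto_atTop_atTop.1 hLs L₀
  refine ⟨J, fun j hj => ?_⟩
  rw [Real.dist_eq]
  exact (hL₀ (Ls j) (heven j) (hJ j hj)).trans_lt (half_lt_self hε)

/-- **(4.15) (Salmhofer–Seiler).**  Let `N ≥ 1`, `ν ≥ 3`, `m > 0`, and let `s` be the limit of the
NJL condensate `⟨σ_0⟩_Λ(m)` along a sequence of even tori `Λ_j = (ℤ/L_jℤ)^ν`, `L_j → ∞` (it exists
and does not depend on the sequence, Cor. 3.9).  Then `1 - 2ms ≤ 2νs² + (2/N) S(ν)` with the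
printed `S(ν)` of (4.3). [cite: SalmhoferSeiler1991, Thm. 4.3 (proof, (4.15))] -/
theorem njl_sd_ineq_limit (hν : 3 ≤ ν) (hN : 1 ≤ N) {m : ℝ} (hm : 0 < m)
    (Ls : ℕ → ℕ) [∀ j, NeZero (Ls j)] (heven : ∀ j, Even (Ls j)) (hLs : Tendsto Ls atTop atTop)
    {s : ℝ} (hs : Tendsto (fun j => expect (ν := ν) (L := Ls j) N m (njlBondCoeff N) (X 0)) atTop (𝓝 s)) :
    1 - 2 * m * s ≤ 2 * ν * s ^ 2 + 2 / N * fluctS ν := by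
  have hν1 : 1 ≤ ν := by omega
  have hfin : ∀ j, 1 - 2 * m * expect (ν := ν) (L := Ls j) N m (njlBondCoeff N) (X 0) ≤
      2 * ν * expect (ν := ν) (L := Ls j) N m (njlBondCoeff N) (X 0) ^ 2 + 2 / N * latticeS ν (Ls j) +
        5 * ν / (2 * N * m ^ 2 * Fintype.card (TorusSite ν (Ls j))) :=
    fun j => njl_sd_ineq_finiteVolume' hν1 (heven j) hN hm
  have hS := tendsto_latticeS hν Ls heven hLs
  -- the finite-size term tends to `0`
  have hc : Tendsto (fun j => ((Fintype.card (TorusSite ν (Ls j)) : ℕ) : ℝ)⁻¹) atTop (𝓝 0) := by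
    refine tendsto_inv_atTop_zero.comp (tendsto_natCast_atTop_atTop.comp ?_)
    refine tendsto_atTop_mono (fun j => ?_) hLs
    rw [Fintype.card_fun, ZMod.card, Fintype.card_fin]
    exact Nat.le_self_pow (by omega) _
  have herr : Tendsto (fun j => 5 * ν / (2 * N * m ^ 2 * (Fintype.card (TorusSite ν (Ls j)) : ℝ)))
      atTop (𝓝 0) := by
    have h := hc.const_mul (5 * ν / (2 * N * m ^ 2) : ℝ)
    rw [mul_zero] at h
    refine h.congr fun j => ?_
    rw [← div_eq_mul_inv, div_div]
  have hl : Tendsto (fun j => 1 - 2 * m * expect (ν := ν) (L := Ls j) N m (njlBondCoeff N) (X 0)) atTop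
      (𝓝 (1 - 2 * m * s)) := tendsto_const_nhds.sub (hs.const_mul _)
  have hr : Tendsto (fun j => 2 * ν * expect (ν := ν) (L := Ls j) N m (njlBondCoeff N) (X 0) ^ 2 +
      2 / N * latticeS ν (Ls j) + 5 * ν / (2 * N * m ^ 2 * Fintype.card (TorusSite ν (Ls j))))
      atTop (𝓝 (2 * ν * s ^ 2 + 2 / N * fluctS ν + 0)) :=
    (((hs.pow 2).const_mul _).add (hS.const_mul _)).add herr
  rw [add_zero] at hr
  exact le_of_tendsto_of_tendsto' hl hr hfin

/-- **Theorem 4.3 (4.6) in the thermodynamic limit**: every such limit `s` of the NJL condensate at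
`m ≥ 0` satisfies `s ≤ s₁ = (√(m² + 2ν) - m)/(2ν)`, the positive solution of the mean-field equation
(4.7). [cite: SalmhoferSeiler1991, Thm. 4.3 (4.6)–(4.7)] -/
theorem njl_condensate_le_meanField (hν : 1 ≤ ν) (hN : 1 ≤ N) {m : ℝ} (hm : 0 ≤ m)
    (Ls : ℕ → ℕ) [∀ j, NeZero (Ls j)] (heven : ∀ j, Even (Ls j))
    {s : ℝ} (hs : Tendsto (fun j => expect (ν := ν) (L := Ls j) N m (njlBondCoeff N) (X 0)) atTop (𝓝 s)) :
    s ≤ (Real.sqrt (m ^ 2 + 2 * ν) - m) / (2 * ν) :=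
  le_of_tendsto' hs fun j => njl_expect_X_le_meanField hν (heven j) (two_le_of_even (heven j)) hN hm 0

/-- **Theorem 4.3 (4.8) (Salmhofer–Seiler): the lower bound on the chiral condensate.**  For the
NJL system / strongly coupled lattice QED (`N ≥ 1`) in `ν ≥ 3` dimensions with `(2/N) S(ν) < 1`, at
every real mass `m > 0`: the thermodynamic limit `s = lim ⟨σ_x⟩_Λ(m)` (along even tori) satisfies
`s ≥ s₂ = (√(m² + 2ν(1 - 2S(ν)/N)) - m)/(2ν)`, the positive solution of
`2νs₂² + 2ms₂ - (1 - (2/N)S(ν)) = 0` (4.9).  (The printed hypothesis `(2/N)S(ν) < 1` is what makes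
`s₂ > 0`; the inequality itself, with `Real.sqrt`, needs no sign condition — see
`njl_condensate_bounds` for the positivity.) [cite: SalmhoferSeiler1991, Thm. 4.3 (4.8)–(4.9)] -/
theorem njl_condensate_ge_meanField (hν : 3 ≤ ν) (hN : 1 ≤ N) {m : ℝ} (hm : 0 < m)
    (Ls : ℕ → ℕ) [∀ j, NeZero (Ls j)] (heven : ∀ j, Even (Ls j)) (hLs : Tendsto Ls atTop atTop)
    {s : ℝ} (hs : Tendsto (fun j => expect (ν := ν) (L := Ls j) N m (njlBondCoeff N) (X 0)) atTop (𝓝 s)) :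
    (Real.sqrt (m ^ 2 + 2 * ν * (1 - 2 * fluctS ν / N)) - m) / (2 * ν) ≤ s := by
  have hν1 : 1 ≤ ν := by omega
  have hν0 : (0 : ℝ) < ν := by exact_mod_cast (show 0 < ν by omega)
  have h := njl_sd_ineq_limit hν hN hm Ls heven hLs hs
  have hs0 : 0 ≤ s := ge_of_tendsto' hs fun j => njl_expect_X_nonneg hν1 (heven j) hN hm.le 0
  have hsq : m ^ 2 + 2 * ν * (1 - 2 * fluctS ν / N) ≤ (2 * ν * s + m) ^ 2 := by
    have e : (2 * ν * s + m) ^ 2 - (m ^ 2 + 2 * ν * (1 - 2 * fluctS ν / N)) =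
        2 * ν * ((2 * ν * s ^ 2 + 2 / N * fluctS ν) - (1 - 2 * m * s)) := by ring
    have h2 : 0 ≤ 2 * ν * ((2 * ν * s ^ 2 + 2 / N * fluctS ν) - (1 - 2 * m * s)) :=
      mul_nonneg (by positivity) (by linarith)
    linarith
  have h3 : Real.sqrt (m ^ 2 + 2 * ν * (1 - 2 * fluctS ν / N)) ≤ 2 * ν * s + m := by
    rw [← Real.sqrt_sq (by positivity : (0 : ℝ) ≤ 2 * ν * s + m)]
    exact Real.sqrt_le_sqrt hsq
  rw [div_le_iff₀ (by positivity)]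
  linarith

/-- **Corollary 3.9 for the condensate**: for `N, ν ≥ 1` there is a function `s : ℝ → ℝ` (the
restriction to the real axis of a function holomorphic off `i[-√(2ν), √(2ν)]`) such that for every
real `m ≠ 0` and every sequence of tori of diverging side, `⟨σ_0⟩_Λ(m) → s(m)`.
[cite: SalmhoferSeiler1991, Cor. 3.9] -/
theorem njl_exists_condensate (hN : 1 ≤ N) (hν : 1 ≤ ν) :
    ∃ s : ℝ → ℝ, ∀ (Ls : ℕ → ℕ) [∀ j, NeZero (Ls j)], Tendsto Ls atTop atTop →
      ∀ m : ℝ, m ≠ 0 →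
        Tendsto (fun j => expect (ν := ν) (L := Ls j) N m (njlBondCoeff N) (X 0)) atTop (𝓝 (s m)) := by
  obtain ⟨f, -, h⟩ := njl_thermodynamicLimit_real hN hν (Finsupp.single (0 : Site ν) 1)
  refine ⟨fun m => (f m).re, fun Ls _ hLs m hm => ?_⟩
  have ht := h Ls hLs m hm
  have hre : ∀ j, njlCorrelation N (Ls j) (Finsupp.single (0 : Site ν) 1) (m : ℂ) =
      ((expect (ν := ν) (L := Ls j) N m (njlBondCoeff N) (X 0) : ℝ) : ℂ) := by
    intro j
    have hp0 : Torus.proj (Ls j) (0 : Site ν) = 0 := by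
      funext i; simp [Torus.proj]
    unfold njlCorrelation
    rw [← njlExpectC_ofReal, Finsupp.mapDomain_single, hp0, map_X]
    rfl
  have h2 := (Complex.continuous_re.tendsto _).comp ht
  refine h2.congr fun j => ?_
  rw [Function.comp_apply, hre, Complex.ofReal_re]

/-- A sequence of even tori of diverging side: `L_j = 2(j+1)`. [folklore] -/
private theorem tendsto_two_mul_succ : Tendsto (fun j : ℕ => 2 * (j + 1)) atTop atTop :=
  tendsto_atTop_atTop.2 fun b => ⟨b, fun j hj => by omega⟩

/-- **Theorem 4.3 for the NJL system / strongly coupled lattice QED, both bounds, in the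
thermodynamic limit.**  For `N ≥ 1`, `ν ≥ 3` and `(2/N)S(ν) < 1`: the condensate
`s(m) = lim_Λ ⟨σ_x⟩_Λ(m)` (which exists for all real `m ≠ 0` along every sequence of tori, Cor. 3.9)
satisfies `s₂(m) ≤ s(m) ≤ s₁(m)` for every `m > 0`, where `s₁`, `s₂ > 0` are the positive
solutions of the mean-field equations (4.7) and (4.9); in particular `s(m) > 0`.
[cite: SalmhoferSeiler1991, Thm. 4.3 (4.6)–(4.9)] -/
theorem njl_condensate_bounds (hν : 3 ≤ ν) (hN : 1 ≤ N) (hS : 2 * fluctS ν / N < 1) :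
    ∃ s : ℝ → ℝ,
      (∀ (Ls : ℕ → ℕ) [∀ j, NeZero (Ls j)], Tendsto Ls atTop atTop → ∀ m : ℝ, m ≠ 0 →
        Tendsto (fun j => expect (ν := ν) (L := Ls j) N m (njlBondCoeff N) (X 0)) atTop (𝓝 (s m))) ∧
      ∀ m : ℝ, 0 < m →
        (Real.sqrt (m ^ 2 + 2 * ν * (1 - 2 * fluctS ν / N)) - m) / (2 * ν) ≤ s m ∧
          s m ≤ (Real.sqrt (m ^ 2 + 2 * ν) - m) / (2 * ν) ∧ 0 < s m := by
  have hν1 : 1 ≤ ν := by omega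
  have hν0 : (0 : ℝ) < ν := by exact_mod_cast (show 0 < ν by omega)
  obtain ⟨s, hs⟩ := njl_exists_condensate (ν := ν) hN hν1
  refine ⟨s, hs, fun m hm => ?_⟩
  haveI : ∀ j : ℕ, NeZero (2 * (j + 1)) := fun j => ⟨by omega⟩
  have heven : ∀ j : ℕ, Even (2 * (j + 1)) := fun j => even_two_mul _
  have ht := hs (fun j => 2 * (j + 1)) tendsto_two_mul_succ m hm.ne'
  have hlow := njl_condensate_ge_meanField hν hN hm (fun j => 2 * (j + 1)) heven
    tendsto_two_mul_succ ht
  -- `s₂ > 0` exactly when `(2/N) S(ν) < 1`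
  have hc : 0 < 1 - 2 * fluctS ν / N := by linarith
  have hs₂ : 0 < (Real.sqrt (m ^ 2 + 2 * ν * (1 - 2 * fluctS ν / N)) - m) / (2 * ν) := by
    refine div_pos (sub_pos.2 ((Real.lt_sqrt hm.le).2 ?_)) (by positivity)
    have : 0 < 2 * ν * (1 - 2 * fluctS ν / N) := by positivity
    linarith
  exact ⟨hlow, njl_condensate_le_meanField hν1 hN hm.le (fun j => 2 * (j + 1)) heven ht,
    hs₂.trans_le hlow⟩

/-- **Corollary 4.4 (1) (Salmhofer–Seiler): chiral symmetry breaking, (4.16).**  Let `ν ≥ 3`,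
`N ≥ 1`, `2S(ν)/N < 1`, and let `s(m)` be, for each `m > 0`, the thermodynamic limit of the NJL
condensate `⟨σ_0⟩_Λ(m)` along some sequence of even tori of diverging side.  Then the chiral order
parameter `X = liminf_{m→0} ⟨ψ̄ψ⟩ = 2N liminf_{m→0+} s(m)` obeys
`1/√(2ν) ≥ X/(2N) ≥ (1/√(2ν)) (1 - (2/N) S(ν))^{1/2} > 0` — "chiral symmetry is broken for all
`N, ν` for which `2S(ν)/N < 1`". [cite: SalmhoferSeiler1991, Cor. 4.4 (1) (4.16)] -/
theorem njl_chiralOrderParameter_bounds (hν : 3 ≤ ν) (hN : 1 ≤ N) (hS : 2 * fluctS ν / N < 1)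
    {s : ℝ → ℝ}
    (hs : ∀ m : ℝ, 0 < m → ∃ (Ls : ℕ → ℕ) (_ : ∀ j, NeZero (Ls j)),
      (∀ j, Even (Ls j)) ∧ Tendsto Ls atTop atTop ∧
        Tendsto (fun j => expect (ν := ν) (L := Ls j) N m (njlBondCoeff N) (X 0)) atTop (𝓝 (s m))) :
    1 / Real.sqrt (2 * ν) * Real.sqrt (1 - 2 * fluctS ν / N) ≤ liminf s (𝓝[>] 0) ∧
      liminf s (𝓝[>] 0) ≤ 1 / Real.sqrt (2 * ν) ∧ 0 < liminf s (𝓝[>] 0) := by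
  have hν1 : 1 ≤ ν := by omega
  have hν0 : (0 : ℝ) < ν := by exact_mod_cast (show 0 < ν by omega)
  -- the bounds at every `m > 0`
  set s₂ : ℝ → ℝ := fun m => (Real.sqrt (m ^ 2 + 2 * ν * (1 - 2 * fluctS ν / N)) - m) / (2 * ν)
    with hs₂
  have hlow : ∀ m : ℝ, 0 < m → s₂ m ≤ s m := by
    intro m hm
    obtain ⟨Ls, hLs0, heven, hLs, ht⟩ := hs m hm
    exact njl_condensate_ge_meanField hν hN hm Ls heven hLs ht
  have hup : ∀ m : ℝ, 0 < m → s m ≤ 1 / Real.sqrt (2 * ν) := by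
    intro m hm
    obtain ⟨Ls, hLs0, heven, hLs, ht⟩ := hs m hm
    exact le_of_tendsto' ht fun j => njl_expect_X_le_inv_sqrt hν1 (heven j) hN hm.le 0
  have hev_low : ∀ᶠ m in 𝓝[>] (0 : ℝ), s₂ m ≤ s m :=
    eventually_nhdsWithin_of_forall fun m hm => hlow m hm
  have hev_up : ∀ᶠ m in 𝓝[>] (0 : ℝ), s m ≤ 1 / Real.sqrt (2 * ν) :=
    eventually_nhdsWithin_of_forall fun m hm => hup m hm
  -- `s₂(m) → (1/√(2ν)) √(1 - 2S/N)` as `m → 0`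
  have hcont : Continuous s₂ := by
    rw [hs₂]
    fun_prop
  have hs₂0 : s₂ 0 = 1 / Real.sqrt (2 * ν) * Real.sqrt (1 - 2 * fluctS ν / N) := by
    simp only [hs₂]
    rw [zero_pow two_ne_zero, zero_add, sub_zero, Real.sqrt_mul (by positivity : (0 : ℝ) ≤ 2 * ν),
      mul_div_right_comm, Real.sqrt_div_self']
  have hlim : Tendsto s₂ (𝓝[>] (0 : ℝ)) (𝓝 (1 / Real.sqrt (2 * ν) * Real.sqrt (1 - 2 * fluctS ν / N))) := by
    rw [← hs₂0]
    exact (hcont.tendsto 0).mono_left nhdsWithin_le_nhds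
  have hbdd : IsBoundedUnder (· ≤ ·) (𝓝[>] (0 : ℝ)) s := ⟨_, hev_up⟩
  have hlower : 1 / Real.sqrt (2 * ν) * Real.sqrt (1 - 2 * fluctS ν / N) ≤ liminf s (𝓝[>] 0) := by
    rw [← hlim.liminf_eq]
    exact liminf_le_liminf hev_low hlim.isBoundedUnder_ge hbdd.isCoboundedUnder_ge
  have hpos : 0 < 1 / Real.sqrt (2 * ν) * Real.sqrt (1 - 2 * fluctS ν / N) :=
    mul_pos (by positivity) (Real.sqrt_pos.2 (by linarith))
  refine ⟨hlower, ?_, hpos.trans_le hlower⟩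
  · obtain ⟨b, hb⟩ := hlim.isBoundedUnder_ge
    have hb' : ∀ᶠ m in 𝓝[>] (0 : ℝ), b ≤ s₂ m := Filter.eventually_map.1 hb
    have hbdd' : IsBoundedUnder (· ≥ ·) (𝓝[>] (0 : ℝ)) s :=
      ⟨b, Filter.eventually_map.2 ((hb'.and hev_low).mono fun m h => h.1.trans h.2)⟩
    exact liminf_le_of_frequently_le hev_up.frequently hbdd'

end Limit

end ComplexSpin

end Literature.MathematicalPhysics.StatisticalMechanics
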